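import Literature.MathematicalPhysics.QuantumFieldTheory.Balaban1985CMP102.SectA
import Literature.MathematicalPhysics.QuantumFieldTheory.Balaban1983to89.B10Eq17LocalSolution
import Literature.MathematicalPhysics.QuantumFieldTheory.Balaban1983to89.B10SectAGathering

/-!
# `Summit.QuantumFields.Balaban3D.Proofs.SectAEq17` — [Balaban1985UV3] **(17)** pp. 259–260 («There exists a unique solution D̃ of
# this equation for A sufficiently small, and it is an analytic function of A with a Taylor expansion beginning with second order
# terms») FROM THE SPINE'S **(15)** (`SectA.Eq15`: `Q(A′) = QA′ + C(A′)`, `C` analytic «beginning with a second order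
# polynomial»): the quadratic bound `|C(Y)| ≤ C₂|Y|²` that LQB's kernel proof of (17) consumes is DERIVED from (15) by a Cauchy
# estimate, so (17) holds for the lane's chart data whenever (15) does — lane `pub-balaban3d`, seat p4 (PLAN.md §3.1 l.138 «(17)
# `B10Eq17*`»)

HONEST FRAMING (lane PLAN.md §0, binding): see `…Proofs.SectAFirstStep`.  Nothing of [Balaban1985UV3] is asserted: (15) is a
hypothesis (spine decl, countersigned F-15), (17) in LQB's print-faithful LOCAL reading `B10Eq17LocalSolution.Eq17Local` is the
conclusion; the support map `b₀(c)` and the linear placement `h` of p. 260 («We assume that D̃(A, b, c) = 0 for all b ≠ b₀(c)»)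
are parameters, as in LQB.

WHAT IS PRINTED.  p. 259 = PDF 5 L29–33: «It is an analytic function of A′ with the decomposition  Q(A′) = QA′ + C(A′),  (15)
where Q = Q(U₁) is the linear averaging operator defined by (124) [4], and C(A′) is an analytic function with an expansion beginning
with a second order polynomial.»; p. 259 L38–p. 260 L12: «we are looking for a function D̃(A, b, c) satisfying the equation
Q(A − D̃(A, c), c) = (QA)(c) − QD̃(A, c) + C(A − D̃(A, c), c) = (QA)(c),  (17)  or QD̃(A, c) = C(A − D̃(A, c), c). … We assume that
D̃(A, b, c) = 0 for all b ≠ b₀(c). … There exists a unique solution D̃ of this equation for A sufficiently small, and it is an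
analytic function of A with a Taylor expansion beginning with second order terms.»

WHAT LQB ALREADY HAS (RE-USED BY NAME): `B10Eq17LocalSolution.Eq17Local` (the local reading of (17)) and
`B10Eq17LocalSolution.exists_radius_eq17Local` — (17) PROVED for every nonlinearity `C̃` with `B13Contraction113.QuadAnalytic C̃ C₂ R`
(the quadratic bound `‖C̃ Y‖ ≤ C₂‖Y‖²` on `‖Y‖ < R` + analyticity along complex lines) that is `AnalyticOnNhd` on `‖Y‖ < R`, and
every bounded linear `h`; `B10SectAGathering.norm_sub_taylorPolynomial_le` (Cauchy-estimate Taylor remainder, finite-dimensional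
domain); `Literature.Analysis.Complex.taylorPolynomial`.

WHAT THIS FILE PROVES (no `sorry`, axioms standard; theorems only):
* §1 `taylorPolynomial_two_eq`, `norm_le_mul_sq_of_jet_zero` — [folklore] Cauchy estimate: a map holomorphic on `ball 0 R`
  (finite-dimensional domain), bounded by `M` on `closedBall 0 (R/2)`, with `h 0 = 0` and `Dh(0) = 0`, satisfies
  `‖h y‖ ≤ (8M/R²)‖y‖²` for `‖y‖ ≤ R/4` — «an expansion beginning with a second order polynomial» made quantitative;
* §2 `quadAnalytic_of_eq15` — from `SectA.Eq15 ℂ 𝒞 Qlin Cnl` with `0 < 𝒞.r` (finite-dimensional `𝔸`, e.g. `M_N(ℂ)`): there are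
  `C₂ ≥ 0`, `R > 0` with `QuadAnalytic Cnl C₂ R` and `AnalyticOnNhd ℂ Cnl {Y | ‖Y‖ < R}` — exactly the two hypotheses on `C̃` of
  LQB's (17);
* §3 `eq17Local_of_eq15` — **(15) ⇒ (17)**: for every support map `b₀ : C → β` and bounded linear placement `h` (`‖h c x‖ ≤ b‖x‖`),
  `∃ ε > 0, ∃ C₂ ≥ 0, ∃ Dt, Eq17Local ℂ b₀ h Cnl ε (4C₂ε²) Dt` (existence, local uniqueness, analyticity, vanishing 1-jet of D̃).
So for the lane's expansion data the object D̃ of (17)/(18)–(22) need not be postulated once (15) is available for the concrete Q.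
-/

namespace Summit.QuantumFields.Balaban3D.Proofs.SectAEq17

open Metric Set
open Literature.MathematicalPhysics.QuantumFieldTheory.Balaban1983to89
open Literature.Analysis.Complex (taylorPolynomial taylorPolynomial_apply)
open Literature.MathematicalPhysics.QuantumFieldTheory.Balaban1985CMP102.SectA (AvgChart Eq15)

/-! ## §1 «beginning with a second order polynomial», quantitatively -/

section Taylor2

variable {E : Type*} [NormedAddCommGroup E] [NormedSpace ℂ E]
  {F : Type*} [NormedAddCommGroup F] [NormedSpace ℂ F]

/-- The Taylor polynomial of order `< 2` at `0`: `h 0 + Dh(0)y`. [folklore] -/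
theorem taylorPolynomial_two_eq (h : E → F) (y : E) : taylorPolynomial h 0 2 y = h 0 + fderiv ℂ h 0 y := by
  rw [taylorPolynomial_apply]
  simp only [sub_zero]
  rw [Finset.sum_range_succ, Finset.sum_range_succ, Finset.sum_range_zero]
  simp only [Nat.factorial_zero, Nat.factorial_one, Nat.cast_one, inv_one, one_smul, iteratedFDeriv_zero_apply,
    iteratedFDeriv_one_apply, zero_add]

variable [FiniteDimensional ℂ E] [CompleteSpace F]

/-- [folklore] **Second-order vanishing, quantitatively** (Cauchy estimate): if `h` is holomorphic on `ball 0 R`, bounded by `M` on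
`closedBall 0 (R/2)`, `h 0 = 0` and `Dh(0) = 0`, then `‖h y‖ ≤ (8M/R²)·‖y‖²` for `‖y‖ ≤ R/4` (LQB
`B10SectAGathering.norm_sub_taylorPolynomial_le` with `N = 2`, `s = ‖y‖`, `R′ = R/2`: remainder `≤ M(2‖y‖/R)²/(1 − 2‖y‖/R) ≤ 8M‖y‖²/R²`).
[folklore] -/
theorem norm_le_mul_sq_of_jet_zero {h : E → F} {R M : ℝ} (hR : 0 < R) (hh : DifferentiableOn ℂ h (ball 0 R))
    (hM : ∀ z ∈ closedBall (0 : E) (R / 2), ‖h z‖ ≤ M) (h0 : h 0 = 0) (h1 : fderiv ℂ h 0 = 0) {y : E}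
    (hy : ‖y‖ ≤ R / 4) : ‖h y‖ ≤ (8 * M / R ^ 2) * ‖y‖ ^ 2 := by
  by_cases hy0 : y = 0
  · subst hy0
    simp [h0]
  have hs : 0 < ‖y‖ := norm_pos_iff.mpr hy0
  have hT : taylorPolynomial h 0 2 y = 0 := by
    rw [taylorPolynomial_two_eq, h0, h1]
    simp
  have key := B10SectAGathering.norm_sub_taylorPolynomial_le (c := (0 : E)) (R := R) (R' := R / 2) (s := ‖y‖)
    (M := M) hh hs (by linarith) (by linarith) hM (y := y) (by simp [mem_closedBall]) 2
  rw [hT, sub_zero] at key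
  have hq : ‖y‖ / (R / 2) = 2 * ‖y‖ / R := by field_simp
  have hM0 : 0 ≤ M := (norm_nonneg _).trans (hM 0 (mem_closedBall_self (by positivity)))
  rw [hq] at key
  have hden : (1 : ℝ) / 2 ≤ 1 - 2 * ‖y‖ / R := by
    have : 2 * ‖y‖ / R ≤ 1 / 2 := by rw [div_le_iff₀ hR]; linarith
    linarith
  calc ‖h y‖ ≤ M * (2 * ‖y‖ / R) ^ 2 / (1 - 2 * ‖y‖ / R) := key
    _ ≤ M * (2 * ‖y‖ / R) ^ 2 / (1 / 2) := div_le_div_of_nonneg_left (by positivity) (by norm_num) hden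
    _ = (8 * M / R ^ 2) * ‖y‖ ^ 2 := by
        field_simp
        ring

end Taylor2

/-! ## §2 (15) supplies the hypotheses of LQB's (17) -/

section Eq15to17

variable {𝔸 : Type*} [NormedRing 𝔸] [NormedAlgebra ℂ 𝔸] [CompleteSpace 𝔸] [FiniteDimensional ℂ 𝔸]
  {β C : Type*} [Fintype β] [Fintype C]

/-- **(15) ⇒ the quadratic bound and analyticity of `C(A′)` that (17) consumes**: if `Eq15 ℂ 𝒞 Qlin Cnl` holds with a positive
fluctuation radius `𝒞.r` (p. 259 L12 «|A′| < 16·3²L²B₃g₀p(g₀)»), then for some `C₂ ≥ 0`, `R > 0` the nonlinear part `Cnl` satisfies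
`B13Contraction113.QuadAnalytic Cnl C₂ R` (‖C(Y)‖ ≤ C₂‖Y‖² on ‖Y‖ < R; analytic along complex lines) and is analytic on
`{‖Y‖ < R}`.  «Beginning with a second order polynomial» (`Cnl 0 = 0`, `DCnl(0) = 0` in `Eq15`) + §1; the sup bound `M` exists by
compactness of closed balls in the finite-dimensional configuration space (`𝔸 = M_N(ℂ)` for the lane). [cite: Balaban1985UV3, (15) p.259] -/
theorem quadAnalytic_of_eq15 (𝒞 : AvgChart 𝔸 β C) (hr : 0 < 𝒞.r) {Qlin : (β → 𝔸) →L[ℂ] (C → 𝔸)}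
    {Cnl : (β → 𝔸) → C → 𝔸} (h15 : Eq15 ℂ 𝒞 Qlin Cnl) :
    ∃ C₂ R : ℝ, 0 ≤ C₂ ∧ 0 < R ∧ B13Contraction113.QuadAnalytic Cnl C₂ R ∧
      AnalyticOnNhd ℂ Cnl {Y : β → 𝔸 | ‖Y‖ < R} := by
  obtain ⟨-, -, hCan, hC0, hCd⟩ := h15
  have hCnhd : AnalyticOnNhd ℂ Cnl (ball 0 𝒞.r) := (isOpen_ball.analyticOn_iff_analyticOnNhd).mp hCan
  set R₀ : ℝ := 𝒞.r / 2 with hR₀def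
  have hR₀ : 0 < R₀ := by positivity
  have hsub : closedBall (0 : β → 𝔸) (R₀ / 2) ⊆ ball 0 𝒞.r := closedBall_subset_ball (by rw [hR₀def]; linarith)
  obtain ⟨M, hM⟩ := (isCompact_closedBall (0 : β → 𝔸) (R₀ / 2)).exists_bound_of_continuousOn
    (hCnhd.continuousOn.mono hsub)
  have hdiff : DifferentiableOn ℂ Cnl (ball 0 R₀) :=
    hCnhd.differentiableOn.mono (ball_subset_ball (by rw [hR₀def]; linarith))
  have hfd : fderiv ℂ Cnl 0 = 0 := hCd.fderiv
  have hM0 : 0 ≤ M := (norm_nonneg _).trans (hM 0 (mem_closedBall_self (by positivity)))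
  have hballsub : {Y : β → 𝔸 | ‖Y‖ < R₀ / 4} ⊆ ball 0 𝒞.r := by
    intro Y hY
    rw [mem_ball_zero_iff]
    have : ‖Y‖ < R₀ / 4 := hY
    rw [hR₀def] at this
    linarith
  refine ⟨8 * M / R₀ ^ 2, R₀ / 4, by positivity, by positivity, ⟨?_, ?_⟩, hCnhd.mono hballsub⟩
  · intro Y hY
    exact norm_le_mul_sq_of_jet_zero hR₀ hdiff hM hC0 hfd hY.le
  · intro P Q
    have haff : Differentiable ℂ (fun ζ : ℂ => P + ζ • Q) := by fun_prop
    refine (hCnhd.differentiableOn.mono hballsub).comp haff.differentiableOn ?_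
    intro ζ hζ
    exact hζ

/-! ## §3 (15) ⇒ (17) -/

/-- **(17) pp. 259–260 FROM (15) p. 259**, for the lane's chart data: given `SectA.Eq15 ℂ 𝒞 Qlin Cnl` with `0 < 𝒞.r`, every support
map `b₀ : C → β` («D̃(A, b, c) = 0 for all b ≠ b₀(c)», p. 260 L6) and every family of bounded linear placements `h(c)`
(`‖h c x‖ ≤ b‖x‖`) admit a radius `ε > 0` («for A sufficiently small»), a constant `C₂ ≥ 0` and a solution map `D̃` with
`Eq17Local ℂ b₀ h Cnl ε (4C₂ε²) D̃` — «There exists a unique solution D̃ of this equation for A sufficiently small, and it is an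
analytic function of A with a Taylor expansion beginning with second order terms» (LQB `B10Eq17LocalSolution.exists_radius_eq17Local`,
its hypotheses supplied by §2). [cite: Balaban1985UV3, (17) pp.259–260] -/
theorem eq17Local_of_eq15 (𝒞 : AvgChart 𝔸 β C) (hr : 0 < 𝒞.r) {Qlin : (β → 𝔸) →L[ℂ] (C → 𝔸)}
    {Cnl : (β → 𝔸) → C → 𝔸} (h15 : Eq15 ℂ 𝒞 Qlin Cnl) (b₀ : C → β) (h : C → 𝔸 →ₗ[ℂ] 𝔸) {b : ℝ} (hb : 0 ≤ b)
    (hh : ∀ c x, ‖h c x‖ ≤ b * ‖x‖) :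
    ∃ ε : ℝ, 0 < ε ∧ ∃ C₂ : ℝ, 0 ≤ C₂ ∧ ∃ Dt : (β → 𝔸) → (C → 𝔸),
      B10Eq17LocalSolution.Eq17Local ℂ b₀ (fun c => ⇑(h c)) Cnl ε (4 * C₂ * ε ^ 2) Dt := by
  obtain ⟨C₂, R, hC₂, hR, hQA, hAn⟩ := quadAnalytic_of_eq15 𝒞 hr h15
  obtain ⟨ε, hε, Dt, h17⟩ := B10Eq17LocalSolution.exists_radius_eq17Local b₀ h hQA hAn hC₂ hb hh hR
  exact ⟨ε, hε, C₂, hC₂, Dt, h17⟩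

end Eq15to17

end Summit.QuantumFields.Balaban3D.Proofs.SectAEq17
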